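import Summits.CriticalPhenomena.PercolationContinuityZ3.Theorems.SoloInformedAnnulusEntrance
import Literature.Probability.Percolation.SharpnessDCTProofs
import HarnessLib

/-!
# The box-crossing face with a free outer scale is an equivalent face
(solo seat `solo-CriticalPhenomena-informed`, paper §7 face 19)

`SoloInformedAnnulusEntrance` proved

  `(∃ δ > 0)(∀ M)(∃ M ≤ n ≤ N) P_{p_c}(boxCrossing d n N) ≤ 1 - δ → θ(p_c) = 0`.

Here we record the converse, so that the box-crossing condition with a FREE outer scale `N` is
an equivalent face of `θ(p_c) = 0` (`percolationContinuity_iff_boxCrossing`), as opposed to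
its fixed-aspect-ratio version `N = k n`, which is a genuinely stronger RSW-type statement.

The converse is the trivial direction and purely combinatorial:

* `boxCrossing_anti` : for `n ≤ N ≤ N'`, `boxCrossing d n N' ⊆ boxCrossing d n N` (an open
  path inside `Λ(N')` from `Λ(n)` to `∂ⁱⁿΛ(N')` meets `∂ⁱⁿΛ(N)` first, inside `Λ(N)`);
* `mem_boxToInfinity_of_forall_mem_boxCrossing` : if `Λ(n) ↔ ∂ⁱⁿΛ(N)` for every `N ≥ n`
  then some site of `Λ(n)` has an infinite open cluster (pigeonhole over the finitely many
  sites of `Λ(n)`; the gate sites at different scales are distinct,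
  `DCT16.notMem_box_of_mem_innerBoundary_box`);
* hence in the continuity world `P_{p_c}(boxCrossing d n N) ↓ 0` as `N → ∞` for every `n`
  (`tendsto_real_boxCrossing_of_continuity`). [folklore]
-/

noncomputable section

namespace Summit.CriticalPhenomena.PercolationContinuityZ3.Theorems

open MeasureTheory ProbabilityTheory Filter Topology
open Literature.Probability.Percolation Literature.Probability.LatticeModels
open Literature.Probability.Percolation.CerfDembinVanishing
open scoped ENNReal

namespace SurfaceTension

variable {d : ℕ}

/-! ## Combinatorics -/

/-- `boxCrossing` is antitone in the outer scale: for `n ≤ N ≤ N'`, a configuration in which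
`Λ(n)` is joined inside `Λ(N')` to `∂ⁱⁿΛ(N')` also joins `Λ(n)` inside `Λ(N)` to `∂ⁱⁿΛ(N)`. -/
theorem boxCrossing_anti {n N N' : ℕ} (hnN : n ≤ N) (hNN' : N ≤ N') {ω : BondConfig (Site d)}
    (h : ω ∈ boxCrossing d n N') : ω ∈ boxCrossing d n N := by
  rcases hNN'.eq_or_lt with rfl | hlt
  · exact h
  obtain ⟨v', hv'⟩ := h
  rw [mem_gate_iff, mem_linkedToBox_iff] at hv'
  obtain ⟨hv'bd, x, hx, hxv'⟩ := hv'
  rw [mem_openClusterIn_iff] at hxv'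
  -- the walk from `x` to `v'` in the open graph restricted to `Λ(N')`
  set H := openGraph ω ⊓ withinGraph (zdGraph d) ↑(box d N') with hH
  have hle : H ≤ zdGraph d := fun u w huw => by
    have h2 := ((SimpleGraph.inf_adj _ _ _ _).1 huw).2
    rw [withinGraph_adj] at h2
    exact h2.1
  obtain ⟨w⟩ := hxv'.symm
  have hxN : x ∈ (↑(box d N) : Set (Site d)) := Finset.mem_coe.2 (box_mono d hnN hx)
  have hv'N : v' ∉ (↑(box d N) : Set (Site d)) := fun hmem =>
    DCT16.notMem_box_of_mem_innerBoundary_box hlt hv'bd (Finset.mem_coe.1 hmem)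
  obtain ⟨b, c, hb, hc, hbc, hr⟩ := exists_exit_of_walk hle (↑(box d N) : Set (Site d)) w hxN hv'N
  refine ⟨b, ?_⟩
  rw [mem_gate_iff, mem_innerBoundary_iff, mem_linkedToBox_iff]
  refine ⟨⟨Finset.mem_coe.1 hb, c, fun h => hc (Finset.mem_coe.2 h), hle hbc⟩, x, hx, ?_⟩
  rw [mem_openClusterIn_iff]
  refine (hr.mono ?_).symm
  -- `H ⊓ within Λ(N) ≤ openGraph ω ⊓ within Λ(N)`
  exact le_inf (inf_le_left.trans inf_le_left) inf_le_right

/-- If `Λ(n)` is joined to `∂ⁱⁿΛ(N)` inside `Λ(N)` for every `N ≥ n`, then some site of `Λ(n)`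
lies in an infinite open cluster. -/
theorem mem_boxToInfinity_of_forall_mem_boxCrossing {n : ℕ} {ω : BondConfig (Site d)}
    (h : ∀ N, n ≤ N → ω ∈ boxCrossing d n N) : ω ∈ boxToInfinity d n := by
  classical
  -- gate sites `v N` and their anchors `x N ∈ Λ(n)` for `N ≥ n` (indexed by `N = n + k`)
  have hsel : ∀ k : ℕ, ∃ v x, v ∈ innerBoundary (zdGraph d) (box d (n + k)) ∧ x ∈ box d n ∧
      (openGraph ω).Reachable x v := by
    intro k
    obtain ⟨v, hv⟩ := h (n + k) (Nat.le_add_right n k)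
    rw [mem_gate_iff, mem_linkedToBox_iff] at hv
    obtain ⟨hvbd, x, hx, hxv⟩ := hv
    rw [mem_openClusterIn_iff] at hxv
    exact ⟨v, x, hvbd, hx, (hxv.mono inf_le_left).symm⟩
  choose v x hv hx hxv using hsel
  -- pigeonhole: some anchor is used for infinitely many scales
  let f : ℕ → box d n := fun k => ⟨x k, hx k⟩
  obtain ⟨x₀, hinf⟩ := Finite.exists_infinite_fiber f
  refine ⟨x₀.1, x₀.2, ?_⟩
  -- the gate sites at these scales are distinct points of the cluster of `x₀`
  have hvinj : Function.Injective v := by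
    intro k k' hkk'
    by_contra hne
    rcases Nat.lt_or_gt_of_ne hne with hlt | hlt
    · have : v k' ∉ box d (n + k) := DCT16.notMem_box_of_mem_innerBoundary_box (by omega) (hv k')
      exact this (hkk' ▸ (mem_innerBoundary_iff.1 (hv k)).1)
    · have : v k ∉ box d (n + k') := DCT16.notMem_box_of_mem_innerBoundary_box (by omega) (hv k)
      exact this (hkk'.symm ▸ (mem_innerBoundary_iff.1 (hv k')).1)
  have hsub : ∀ k : f ⁻¹' {x₀}, v k.1 ∈ openCluster ω x₀.1 := by
    rintro ⟨k, hk⟩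
    have hk' : x k = x₀.1 := by
      have := (Set.mem_preimage.1 hk)
      rw [Set.mem_singleton_iff] at this
      exact congrArg Subtype.val this
    show (openGraph ω).Reachable x₀.1 (v k)
    rw [← hk']
    exact hxv k
  haveI : Infinite (f ⁻¹' {x₀}) := hinf
  exact Set.infinite_of_injective_forall_mem (fun a b hab => Subtype.ext (hvinj hab)) hsub

/-- `⋂_{k} boxCrossing d n (n + k) ⊆ {Λ(n) ↔ ∞}`. -/
theorem iInter_boxCrossing_subset_boxToInfinity (n : ℕ) :
    ⋂ k : ℕ, boxCrossing d n (n + k) ⊆ boxToInfinity d n := by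
  intro ω hω
  rw [Set.mem_iInter] at hω
  refine mem_boxToInfinity_of_forall_mem_boxCrossing fun N hN => ?_
  obtain ⟨k, rfl⟩ := Nat.exists_eq_add_of_le hN
  exact hω k

/-! ## The continuity world: box-crossing probabilities tend to zero -/

/-- If `θ(p_c) = 0` then for every `n`, `P_{p_c}(Λ(n) ↔ ∂ⁱⁿΛ(N) in Λ(N)) → 0` as `N → ∞`. -/
theorem tendsto_real_boxCrossing_of_continuity (hcont : PercolationContinuity d) (n : ℕ) :
    Tendsto (fun N => (bondPercolation (zdGraph d) (criticalProbI d)).real (boxCrossing d n N))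
      atTop (𝓝 0) := by
  set μ := bondPercolation (zdGraph d) (criticalProbI d) with hμ
  -- shifted index `N = n + k`: an antitone family
  have hanti : Antitone fun k : ℕ => boxCrossing d n (n + k) := by
    intro k k' hkk' ω hω
    exact boxCrossing_anti (Nat.le_add_right n k) (by omega) hω
  have hlim : Tendsto (fun k : ℕ => μ (boxCrossing d n (n + k))) atTop
      (𝓝 (μ (⋂ k : ℕ, boxCrossing d n (n + k)))) :=
    tendsto_measure_iInter_atTop (fun k => (measurableSet_boxCrossing n (n + k)).nullMeasurableSet)
      hanti ⟨0, measure_ne_top _ _⟩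
  have hzero : μ (⋂ k : ℕ, boxCrossing d n (n + k)) = 0 := by
    refine le_antisymm ?_ bot_le
    calc μ (⋂ k : ℕ, boxCrossing d n (n + k)) ≤ μ (boxToInfinity d n) :=
          measure_mono (iInter_boxCrossing_subset_boxToInfinity n)
      _ = 0 := (percolationContinuity_iff_forall_boxToInfinity d).1 hcont n
  rw [hzero] at hlim
  have hreal : Tendsto (fun k : ℕ => μ.real (boxCrossing d n (n + k))) atTop (𝓝 0) := by
    have := (ENNReal.tendsto_toReal ENNReal.zero_ne_top).comp hlim
    simpa [measureReal_def, Function.comp_def] using this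
  -- undo the shift
  rw [← Filter.tendsto_add_atTop_iff_nat n]
  simpa [add_comm] using hreal

/-- **Face 19.** `θ(p_c) = 0` on `ℤ^d` iff for some `δ > 0` there are pairs `n ≤ N` with `n`
arbitrarily large and `P_{p_c}(Λ(n) ↔ ∂ⁱⁿΛ(N) in Λ(N)) ≤ 1 - δ`. -/
theorem percolationContinuity_iff_boxCrossing :
    PercolationContinuity d ↔
      ∃ δ : ℝ, 0 < δ ∧ ∀ M : ℕ, ∃ n N, M ≤ n ∧ n ≤ N ∧
        (bondPercolation (zdGraph d) (criticalProbI d)).real (boxCrossing d n N) ≤ 1 - δ := by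
  constructor
  · intro hcont
    refine ⟨1 / 2, by norm_num, fun M => ?_⟩
    have h := tendsto_real_boxCrossing_of_continuity hcont M
    have hev : ∀ᶠ N in atTop, (bondPercolation (zdGraph d) (criticalProbI d)).real
        (boxCrossing d M N) ≤ 1 - 1 / 2 := by
      have : (0 : ℝ) < 1 - 1 / 2 := by norm_num
      exact (h.eventually (ge_mem_nhds this)).mono fun N hN => hN
    obtain ⟨N, hN⟩ := (hev.and (eventually_ge_atTop M)).exists
    exact ⟨M, N, le_rfl, hN.2, hN.1⟩
  · rintro ⟨δ, hδ, h⟩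
    exact percolationContinuity_of_boxCrossing_le hδ h

/-- The `ℤ³` instance of face 19. -/
theorem percolationContinuityZ3_iff_boxCrossing :
    PercolationContinuityZ3 ↔
      ∃ δ : ℝ, 0 < δ ∧ ∀ M : ℕ, ∃ n N, M ≤ n ∧ n ≤ N ∧
        (bondPercolation (zdGraph 3) (criticalProbI 3)).real (boxCrossing 3 n N) ≤ 1 - δ :=
  percolationContinuity_iff_boxCrossing

end SurfaceTension

end Summit.CriticalPhenomena.PercolationContinuityZ3.Theorems
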